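import Mathlib
import Summits.MatrixMultiplication.MatrixMultiplication.Theses.SnSubsetDichotomy

/-!
# The AM–GM atom — line `mover-covering-amgm`, crux `JuntaBranch` (stmt-MatrixMultiplication-8304)

The one inequality behind Blasiak–Church–Cohn–Grochow–Umans 2017, Thm 4.2 (arXiv:1712.02302, p. 10:
"∑ aᵢ ≤ n … ∏ aᵢ ≤ (n/t)^t"), separated from the Young-subgroup setting and stated for an arbitrary
finite set `T ⊆ S_n` of permutations: if the SOURCE SUPPORTS `A_k(T) = {j | ∃ τ ∈ T, τ j = L k}` of `T`
on a block `L` (an injective `t`-tuple of points) are pairwise disjoint, then some injective source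
tuple `J` carries at least a `(t/n)^t` fraction of `T`: `|T|·(t/n)^t ≤ |T ∩ U_{J→L}|`, where
`U_{J→L} = {σ | σ ∘ J = L}` is the umvirate.  Pure counting (disjointness ⇒ `∑|A_k| ≤ n`, weighted
AM–GM, pigeonhole over `∏ A_k`); no TPP, no density.  This is the proved "lever arithmetic" of the line
`mover-covering-amgm` (its structural stub asserting the disjointness in Large TPP triples is dead —
see `Theorems/SnSubsetDichotomyJuntaBranchPartnersDisjointBoundary.lean` and the line's dead note); the
theorem itself is unconditional and is what any future "blocky partners" argument would call.
-/

open Literature.Combinatorics.Additive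
open scoped Classical

set_option linter.dupNamespace false

namespace Summit.MatrixMultiplication.MatrixMultiplication.Theorems.JuntaBranch

/-- **The AM–GM atom (BCCGU's `∏ aᵢ ≤ (n/t)^t`, subsets form; proved by the crux-plan planner of line
`mover-covering-amgm` in the workfile `Cruxes/JuntaBranch/Lines/mover_covering_amgm.lean`, moved to the tree verbatim by
lead gen 1).** If the source
supports `A_k(T) = {j | ∃ τ ∈ T, τ j = L k}` of `T` on a block `L` are pairwise disjoint, some
injective source tuple `J` carries at least a `(t/n)^t` fraction of `T`:
`|T|·(t/n)^t ≤ |T ∩ U_{J→L}|`. Proof: the source tuple `τ ↦ (τ⁻¹(L k))_k` maps `T` into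
`Fintype.piFinset A` (`∏_k |A_k|` tuples); disjointness in `Fin n` gives `∑_k |A_k| ≤ n`
(`Finset.card_biUnion`), the weighted AM–GM inequality (`Real.geom_mean_le_arith_mean_weighted`,
weights `1/t`) gives `∏_k |A_k| ≤ (n/t)^t`, and the pigeonhole principle
(`Finset.exists_le_card_fiber_of_nsmul_le_card_of_maps_to`) a tuple `y` whose fibre — contained in
the atom `(y → L)` — has `≥ |T|(t/n)^t` elements; `y = τ⁻¹ ∘ L` is injective (or the bound is
`≤ 0` and `J := L` works). Degenerate cases `t = 0`, `T = ∅` are trivial. No hypothesis on `T`: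
scale-free, which is why the lever needs no density (route obstruction O1 void). -/
theorem amgmAtom :
    ∀ n t : ℕ, ∀ T : Finset (Equiv.Perm (Fin n)), ∀ L : Fin t → Fin n, Function.Injective L →
      (∀ k k' : Fin t, k ≠ k' → ∀ j : Fin n,
          (∃ τ ∈ T, τ j = L k) → (∃ τ' ∈ T, τ' j = L k') → False) →
      ∃ J : Fin t → Fin n, Function.Injective J ∧
        (T.card : ℝ) * ((t : ℝ) / n) ^ t ≤ ((T.filter (fun σ => ∀ k, σ (J k) = L k)).card : ℝ) := by
  intro n t T L hL hdisj
  classical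
  -- trivial cases: `t = 0` and `T = ∅`
  rcases Nat.eq_zero_or_pos t with rfl | ht
  · exact ⟨L, hL, by simp⟩
  rcases T.eq_empty_or_nonempty with rfl | hT
  · exact ⟨L, hL, by simp⟩
  have hn : 0 < n := Fin.pos (L ⟨0, ht⟩)
  have ht0 : (0 : ℝ) < t := by exact_mod_cast ht
  have hn0 : (0 : ℝ) < n := by exact_mod_cast hn
  -- source supports `A k` and the source-tuple map `f`
  set A : Fin t → Finset (Fin n) := fun k => Finset.univ.filter (fun j => ∃ τ ∈ T, τ j = L k)
    with hA
  set f : Equiv.Perm (Fin n) → (Fin t → Fin n) := fun τ k => τ.symm (L k) with hf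
  have hmaps : ∀ τ ∈ T, f τ ∈ Fintype.piFinset A := by
    intro τ hτ
    rw [Fintype.mem_piFinset]
    intro k
    simp only [hA, Finset.mem_filter, Finset.mem_univ, true_and]
    exact ⟨τ, hτ, by simp [hf]⟩
  obtain ⟨τ₀, hτ₀⟩ := hT
  have hne : (Fintype.piFinset A).Nonempty := ⟨f τ₀, hmaps τ₀ hτ₀⟩
  -- disjoint supports: ∑ |A k| ≤ n
  have hsum : ∑ k, ((A k).card : ℝ) ≤ n := by
    have hdj : ∀ k ∈ (Finset.univ : Finset (Fin t)), ∀ k' ∈ (Finset.univ : Finset (Fin t)),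
        k ≠ k' → Disjoint (A k) (A k') := by
      intro k _ k' _ hkk
      rw [Finset.disjoint_left]
      intro j hj hj'
      simp only [hA, Finset.mem_filter, Finset.mem_univ, true_and] at hj hj'
      exact hdisj k k' hkk j hj hj'
    have h1 : ∑ k, (A k).card = (Finset.univ.biUnion A).card := (Finset.card_biUnion hdj).symm
    have h2 : (Finset.univ.biUnion A).card ≤ n := by
      simpa using Finset.card_le_univ (Finset.univ.biUnion A)
    have h3 : ∑ k, (A k).card ≤ n := h1 ▸ h2
    exact_mod_cast h3
  -- AM–GM: ∏ |A k| ≤ (n/t)^t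
  have hprod : ∏ k, ((A k).card : ℝ) ≤ ((n : ℝ) / t) ^ t := by
    have hwsum : ∑ _k : Fin t, (1 : ℝ) / t = 1 := by
      rw [Finset.sum_const, Finset.card_univ, Fintype.card_fin, nsmul_eq_mul]
      field_simp
    have hw := Real.geom_mean_le_arith_mean_weighted (Finset.univ : Finset (Fin t))
      (fun _ => (1 : ℝ) / t) (fun k => ((A k).card : ℝ)) (fun _ _ => by positivity) hwsum
      (fun _ _ => Nat.cast_nonneg _)
    have hrhs : ∑ k : Fin t, (1 : ℝ) / t * ((A k).card : ℝ) ≤ (n : ℝ) / t := by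
      rw [← Finset.mul_sum]
      calc (1 : ℝ) / t * ∑ k, ((A k).card : ℝ) ≤ (1 : ℝ) / t * n :=
            mul_le_mul_of_nonneg_left hsum (by positivity)
        _ = (n : ℝ) / t := by ring
    have hg0 : 0 ≤ ∏ k : Fin t, ((A k).card : ℝ) ^ ((1 : ℝ) / t) :=
      Finset.prod_nonneg (fun _ _ => by positivity)
    have h1 := pow_le_pow_left₀ hg0 (hw.trans hrhs) t
    have e : (∏ k : Fin t, ((A k).card : ℝ) ^ ((1 : ℝ) / t)) ^ t = ∏ k, ((A k).card : ℝ) := by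
      rw [← Finset.prod_pow]
      apply Finset.prod_congr rfl
      intro k _
      rw [← Real.rpow_natCast, ← Real.rpow_mul (Nat.cast_nonneg _)]
      rw [show (1 : ℝ) / t * ((t : ℕ) : ℝ) = 1 by field_simp]
      exact Real.rpow_one _
    rw [e] at h1
    exact h1
  -- pigeonhole on the source-tuple map
  have hcardpi : ((Fintype.piFinset A).card : ℝ) = ∏ k, ((A k).card : ℝ) := by
    rw [Fintype.card_piFinset, Nat.cast_prod]
  have hq0 : 0 ≤ ((t : ℝ) / n) ^ t := by positivity
  have hb' : (Fintype.piFinset A).card • ((T.card : ℝ) * ((t : ℝ) / n) ^ t) ≤ (T.card : ℝ) := by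
    rw [nsmul_eq_mul, hcardpi]
    have hq : ((n : ℝ) / t) ^ t * ((t : ℝ) / n) ^ t = 1 := by
      rw [← mul_pow, show (n : ℝ) / t * ((t : ℝ) / n) = 1 by field_simp, one_pow]
    calc (∏ k, ((A k).card : ℝ)) * ((T.card : ℝ) * ((t : ℝ) / n) ^ t)
        = (T.card : ℝ) * ((∏ k, ((A k).card : ℝ)) * ((t : ℝ) / n) ^ t) := by ring
      _ ≤ (T.card : ℝ) * (((n : ℝ) / t) ^ t * ((t : ℝ) / n) ^ t) := by gcongr
      _ = (T.card : ℝ) := by rw [hq, mul_one]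
  obtain ⟨y, hy, hfib⟩ := Finset.exists_le_card_fiber_of_nsmul_le_card_of_maps_to hmaps hne hb'
  -- the fibre over `y` is the atom `(y → L)` of `T`
  have hsub : T.filter (fun τ => f τ = y) ⊆ T.filter (fun σ => ∀ k, σ (y k) = L k) := by
    intro τ hτ
    simp only [Finset.mem_filter] at hτ ⊢
    refine ⟨hτ.1, fun k => ?_⟩
    have hk := congrFun hτ.2 k
    simp only [hf] at hk
    rw [← hk]
    simp
  by_cases hfne : (T.filter (fun τ => f τ = y)).Nonempty
  · obtain ⟨τ, hτ⟩ := hfne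
    simp only [Finset.mem_filter] at hτ
    refine ⟨y, ?_, ?_⟩
    · rw [← hτ.2]
      exact τ.symm.injective.comp hL
    · exact hfib.trans (by exact_mod_cast Finset.card_le_card hsub)
  · refine ⟨L, hL, ?_⟩
    rw [Finset.not_nonempty_iff_eq_empty] at hfne
    rw [hfne] at hfib
    simp only [Finset.card_empty, Nat.cast_zero] at hfib
    exact hfib.trans (Nat.cast_nonneg _)


end Summit.MatrixMultiplication.MatrixMultiplication.Theorems.JuntaBranch
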